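import Summits.QuantumFields.YangMills.Theorems.UnitScaleTiltProp7FibreLevelSupLocalGauge
import HarnessLib

/-!
# Route `UnitScaleTilt`, crux K1 «MinimiserStabilityRegPr» (stmt-QuantumFields-19200), route-R under RULING (Λ) — THE DRIFT LETTER:
# the true `(0.4)`-constraint value of a GAUGE-MOVED on-fibre competitor `W^u` IS the coarse pure gauge `V^{ū}V^* − 1` = the level-`k` ratio of the pure-gauge pair `(U₀^u, U₀)`
# (exact identities), the drift's bond algebra `1 + D = g(1+Y)^*g^*·(1+Y′)` and sup letter `‖D‖ ≤ ‖Y‖ + ‖Y′‖ + ‖Y‖‖Y′‖`, and its per-coarse-bond size from the plaquette bound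

Cell `ym3-torus`, keyed width hand `ym-routeR-w1` gen 2 (D-0154 (3c); offer (c1′) 2026-08-28 10:37Z, GO by ★routeR-w2 g1 10:40Z whose located readings (ii)∕(iv) and memo #54
`LOCATE-LAMBDA-DRIFT-SLOTS-routeRw2g1.md` these letters serve).  THEOREMS ONLY (0 `def`, 0 `sorry`); `--supports stmt-QuantumFields-19200`, count-neutral.  YM₃ on T³ is a ladder
rung (R3), not the Clay problem; nothing here claims the stub, the crux, d = 4 or the mass gap.

THE POINT.  Under ★p1's RULING (Λ) (bus 10:04:53Z; ★★OWNER RULING №25) stub P is re-penned for the unpinned (Landau ∕ `ℓ²`-optimal) representative `W^u` of an on-fibre competitor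
`W` (`avg^k W = avg^k U₀ =: V`).  Such a representative LEAVES the fibre: by covariance of the iterated average (✓ `T4Continuum.iter_gaugeAct`) `avg^k (W^u) = V^{ū}`, `ū = transfUp u k`
(§1), so the engine's constraint slot `hQ : Σ_c‖Q_k Y′ c‖² ≤ Z_Q` (✓p622368 ∕ ✓p625333) sees, to leading order, the COARSE PURE GAUGE `pertVar V (V^{ū}) = V^{ū}V^* − 1` — which is ALSO
the level-`k` ratio of the pure-gauge pair `(U₀^u, U₀)` (§1), so every fibre-sup ∕ fibre-mass theorem for pairs `(X, U₀)` (✓p620855, ✓p624016, ★routeR-w3 g2's F1–F3) applies to it.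
§2 is the exact bond algebra of the three ratios `Y = WU₀^* − 1` (competitor), `Y′ = (W^u)U₀^* − 1` (moved competitor), `D = (U₀^u)U₀^* − 1` (moved background):
`1 + D_b = u(b₋)(1 + Y_b)^*u(b₋)^*·(1 + Y′_b)` (unitarity of `1 + Y_b`), whence `D_b = gY_b^*g^* + Y′_b + gY_b^*g^*Y′_b` and the SUP LETTER `‖D_b‖ ≤ ‖Y_b‖ + ‖Y′_b‖ + ‖Y_b‖‖Y′_b‖`
(no division, no smallness).  §3 feeds §1–§2 into ✓ `Prop7FibreLevelSupLocalGauge.norm_pertVar_iter_le_of_plaqBound` (the (T1) local gauge from the (14) plaquette bound):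
per coarse bond `‖pertVar (avg^k U₀)(avg^k (W^u)) c‖ ≤ 2(d+1)L^k·(s + s′ + ss′)` from the two sups `s, s′` and `dist1(U₀(∂p)) ≤ δ`.  NOT HERE (the open rows of memo #54 §4): the
drift's `ℓ²`-MASS against `ℓ⁻¹Σ‖Y‖²` with a constant the `−96ℓ⁻¹Z_Q` slot tolerates, and the exact multiplier pairing on the S side.

WHAT IS PROVED (ns `…Theorems.Prop7FibreDriftLetter`; any `Params`, `SU(n)`).
* §1 (any one-step averagings `av`, `k ≤ m+K`) ★ `iter_gaugeAct_of_fibre` (`avg^k (W^u) = (avg^k U₀)^{ū}`), `iter_gaugeAct_of_fibre'` (`= avg^k (U₀^u)`),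
  ★★ `pertVar_iter_gaugeAct_of_fibre` (constraint value of `W^u` = level-`k` ratio of `(U₀^u, U₀)`), ★★ `pertVar_iter_gaugeAct_of_fibre_eq_coarseGauge` (= `pertVar V (V^{ū})`),
  `pertVar_iter_gaugeAct_of_fibre_eq` (the matrix form `ū(c₋)V_cū(c₊)^*V_c^* − 1`).
* §2 (any level) `one_add_pertVar_mul_star`, `star_one_add_pertVar_mul`, ★ `one_add_pertVar_gaugeAct_background_eq`, ★ `pertVar_gaugeAct_background_eq`,
  ★★ `norm_pertVar_gaugeAct_background_le`.
* §3 (the `(0.4)`-averages `blockAvg ℰp`, `k < m+K`) ★★ `norm_fibreDrift_le_of_plaqBound`.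
HONEST SCOPE.  Identities, one triangle inequality, one instantiation of a landed theorem; nothing of Bałaban's analysis is asserted; no `ℓ²` drift bound is claimed.

References: T. Bałaban, CMP 98 (1985) 17–51 [Balaban1985Averaging] ((8), (11)–(13) p.19; Prop. 4 (134)–(135) p.38); CMP 102 (1985) 277–309 [Balaban1985Variational]
((15)–(16) p.280); CMP 109 (1987) 249–301 [Balaban1987RG1] ((0.4) p.253, (1.11)–(1.12) p.262).
-/

set_option autoImplicit false

noncomputable section

open scoped BigOperators Matrix.Norms.L2Operator Matrix

namespace Summit.QuantumFields.YangMills.Theorems.Prop7FibreDriftLetter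

open Literature.MathematicalPhysics.QuantumFieldTheory.Balaban1983to89
open Finset T4Continuum BlockAveraging ExpMeanLog
open BlockAveragingEMLLinearisedBackground (pertVar pertVar_eq)
open Summit.QuantumFields.YangMills.Theorems.Prop7FibreLevelSupLocalGauge (norm_pertVar_iter_le_of_plaqBound)

variable {P : Params} {n : Type*} [Fintype n] [DecidableEq n] [Nonempty n]

/-! ## §1 The averages of a gauge-moved on-fibre competitor: `avg^k (W^u) = (avg^k U₀)^{ū}` and the constraint value is the level-`k` ratio of `(U₀^u, U₀)` -/

/-- ★ **A GAUGE-MOVED ON-FIBRE COMPETITOR AVERAGES TO THE MOVED BACKGROUND AVERAGE**: `k ≤ m + K`; if `avg^k W = avg^k U₀` then `avg^k (W^u) = (avg^k U₀)^{ū}`,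
`ū = transfUp u k` (covariance ✓ `T4Continuum.iter_gaugeAct`). [cite: Balaban1985Averaging, (11)-(13) p.19] -/
theorem iter_gaugeAct_of_fibre (av : ∀ j, Averaging P j (Matrix.specialUnitaryGroup n ℂ)) {k : ℕ} (hk : k ≤ P.m + P.K)
    (u : GaugeTransf P 0 (Matrix.specialUnitaryGroup n ℂ)) (U₀ W : GaugeField P 0 (Matrix.specialUnitaryGroup n ℂ))
    (hfib : Averaging.iter av k W = Averaging.iter av k U₀) :
    Averaging.iter av k (GaugeField.gaugeAct u W) = GaugeField.gaugeAct (transfUp u k) (Averaging.iter av k U₀) := by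
  rw [iter_gaugeAct av u k hk W, hfib]

/-- ★ The same read against the moved BACKGROUND: `avg^k (W^u) = avg^k (U₀^u)` on the fibre. [cite: Balaban1985Averaging, (11)-(13) p.19] -/
theorem iter_gaugeAct_of_fibre' (av : ∀ j, Averaging P j (Matrix.specialUnitaryGroup n ℂ)) {k : ℕ} (hk : k ≤ P.m + P.K)
    (u : GaugeTransf P 0 (Matrix.specialUnitaryGroup n ℂ)) (U₀ W : GaugeField P 0 (Matrix.specialUnitaryGroup n ℂ))
    (hfib : Averaging.iter av k W = Averaging.iter av k U₀) :
    Averaging.iter av k (GaugeField.gaugeAct u W) = Averaging.iter av k (GaugeField.gaugeAct u U₀) := by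
  rw [iter_gaugeAct_of_fibre av hk u U₀ W hfib, iter_gaugeAct av u k hk U₀]

/-- ★★ **THE TRUE CONSTRAINT VALUE OF THE MOVED COMPETITOR IS THE LEVEL-`k` RATIO OF THE PURE-GAUGE PAIR `(U₀^u, U₀)`** — i.e. the level-`k` covariant derivative
`ū(c₋)·V_c·ū(c₊)^*·V_c^* − 1` of the descended gauge function along `V = avg^k U₀`: on the fibre,
`pertVar (avg^k U₀) (avg^k (W^u)) c = pertVar (avg^k U₀) (avg^k (U₀^u)) c`.  Every fibre-sup ∕ fibre-mass theorem for pairs `(X, U₀)` therefore applies to it with `X := U₀^u`.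
[cite: Balaban1985Averaging, (11)-(13) p.19; Balaban1987RG1, (0.4) p.253] -/
theorem pertVar_iter_gaugeAct_of_fibre (av : ∀ j, Averaging P j (Matrix.specialUnitaryGroup n ℂ)) {k : ℕ} (hk : k ≤ P.m + P.K)
    (u : GaugeTransf P 0 (Matrix.specialUnitaryGroup n ℂ)) (U₀ W : GaugeField P 0 (Matrix.specialUnitaryGroup n ℂ))
    (hfib : Averaging.iter av k W = Averaging.iter av k U₀) (c : PBond P k) :
    pertVar (Averaging.iter av k U₀) (Averaging.iter av k (GaugeField.gaugeAct u W)) c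
      = pertVar (Averaging.iter av k U₀) (Averaging.iter av k (GaugeField.gaugeAct u U₀)) c := by
  rw [iter_gaugeAct_of_fibre' av hk u U₀ W hfib]

/-- ★★ The same read as a COARSE PURE GAUGE: `pertVar (avg^k U₀) (avg^k (W^u)) c = pertVar V (V^{ū}) c`, `V = avg^k U₀`, `ū = transfUp u k` — the `hDrift` object of the
(Λ) pen (★routeR-w2 g1's memo #54 §4). [cite: Balaban1985Averaging, (11)-(13) p.19; Balaban1987RG1, (0.4) p.253] -/
theorem pertVar_iter_gaugeAct_of_fibre_eq_coarseGauge (av : ∀ j, Averaging P j (Matrix.specialUnitaryGroup n ℂ)) {k : ℕ} (hk : k ≤ P.m + P.K)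
    (u : GaugeTransf P 0 (Matrix.specialUnitaryGroup n ℂ)) (U₀ W : GaugeField P 0 (Matrix.specialUnitaryGroup n ℂ))
    (hfib : Averaging.iter av k W = Averaging.iter av k U₀) (c : PBond P k) :
    pertVar (Averaging.iter av k U₀) (Averaging.iter av k (GaugeField.gaugeAct u W)) c
      = pertVar (Averaging.iter av k U₀) (GaugeField.gaugeAct (transfUp u k) (Averaging.iter av k U₀)) c := by
  rw [iter_gaugeAct_of_fibre av hk u U₀ W hfib]

/-- The explicit form: `pertVar V (V^{ū}) c = ū(c₋)·V_c·ū(c₊)^*·V_c^* − 1`, `V = avg^k U₀`, `ū = transfUp u k`. [cite: Balaban1985Averaging, (8) p.19, (11) p.19] -/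
theorem pertVar_iter_gaugeAct_of_fibre_eq (av : ∀ j, Averaging P j (Matrix.specialUnitaryGroup n ℂ)) {k : ℕ} (hk : k ≤ P.m + P.K)
    (u : GaugeTransf P 0 (Matrix.specialUnitaryGroup n ℂ)) (U₀ W : GaugeField P 0 (Matrix.specialUnitaryGroup n ℂ))
    (hfib : Averaging.iter av k W = Averaging.iter av k U₀) (c : PBond P k) :
    pertVar (Averaging.iter av k U₀) (Averaging.iter av k (GaugeField.gaugeAct u W)) c
      = ((transfUp u k c.src : Matrix.specialUnitaryGroup n ℂ) : Matrix n n ℂ) * ((Averaging.iter av k U₀ c : Matrix.specialUnitaryGroup n ℂ) : Matrix n n ℂ)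
          * star ((transfUp u k c.tgt : Matrix.specialUnitaryGroup n ℂ) : Matrix n n ℂ) * star ((Averaging.iter av k U₀ c : Matrix.specialUnitaryGroup n ℂ) : Matrix n n ℂ) - 1 := by
  rw [iter_gaugeAct_of_fibre av hk u U₀ W hfib, pertVar_eq]
  have hcoe : ((GaugeField.gaugeAct (transfUp u k) (Averaging.iter av k U₀) c : Matrix.specialUnitaryGroup n ℂ) : Matrix n n ℂ)
      = ((transfUp u k c.src : Matrix.specialUnitaryGroup n ℂ) : Matrix n n ℂ) * ((Averaging.iter av k U₀ c : Matrix.specialUnitaryGroup n ℂ) : Matrix n n ℂ)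
          * star ((transfUp u k c.tgt : Matrix.specialUnitaryGroup n ℂ) : Matrix n n ℂ) := by
    show (((transfUp u k c.src * Averaging.iter av k U₀ c * (transfUp u k c.tgt)⁻¹ : Matrix.specialUnitaryGroup n ℂ)) : Matrix n n ℂ) = _
    rw [Submonoid.coe_mul, Submonoid.coe_mul]
    rfl
  rw [hcoe]

/-! ## §2 The bond algebra of the three ratios `Y = WU₀^* − 1`, `Y′ = (W^u)U₀^* − 1`, `D = (U₀^u)U₀^* − 1` -/

omit [Nonempty n] in
/-- `(1 + Y_b)` is unitary: `(W_bU₀(b)^*)·(W_bU₀(b)^*)^* = 1`. [folklore] -/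
theorem one_add_pertVar_mul_star {j : ℕ} (U₀ W : GaugeField P j (Matrix.specialUnitaryGroup n ℂ)) (b : PBond P j) :
    (1 + pertVar U₀ W b) * star (1 + pertVar U₀ W b) = 1 := by
  rw [pertVar_eq, add_sub_cancel, star_mul, star_star, mul_assoc, ← mul_assoc (star ((U₀ b : Matrix.specialUnitaryGroup n ℂ) : Matrix n n ℂ)),
    Unitary.star_mul_self_of_mem (U₀ b).2.1, one_mul, Unitary.mul_star_self_of_mem (W b).2.1]

omit [Nonempty n] in
/-- … and `(1 + Y_b)^*·(1 + Y_b) = 1`. [folklore] -/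
theorem star_one_add_pertVar_mul {j : ℕ} (U₀ W : GaugeField P j (Matrix.specialUnitaryGroup n ℂ)) (b : PBond P j) :
    star (1 + pertVar U₀ W b) * (1 + pertVar U₀ W b) = 1 := by
  rw [pertVar_eq, add_sub_cancel, star_mul, star_star, mul_assoc, ← mul_assoc (star ((W b : Matrix.specialUnitaryGroup n ℂ) : Matrix n n ℂ)),
    Unitary.star_mul_self_of_mem (W b).2.1, one_mul, Unitary.mul_star_self_of_mem (U₀ b).2.1]

/-- ★ **THE EXACT BOND ALGEBRA**: with `Y = WU₀^* − 1`, `Y′ = (W^u)U₀^* − 1`, `D = (U₀^u)U₀^* − 1` and `g = u(b₋)`: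
`D_b = g·Y_b^*·g^* + Y′_b + (g·Y_b^*·g^*)·Y′_b` … no: `1 + D_b = (g(1 + Y_b)^*g^*)·(1 + Y′_b)`, i.e. `D_b = gY_b^*g^* + Y′_b + gY_b^*g^*·Y′_b`.
(`W^u_b = gW_b h^*`, `U₀^u_b = gU₀(b)h^*`, `h = u(b₊)`: `1 + Y′_b = g(1 + Y_b)U₀(b)h^*U₀(b)^*` and `1 + D_b = gU₀(b)h^*U₀(b)^*`, so `1 + D_b = g(1+Y_b)^*g^*·(1 + Y′_b)`.)
[cite: Balaban1985Variational, (15) p.280; Balaban1985Averaging, (8) p.19] -/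
theorem one_add_pertVar_gaugeAct_background_eq {j : ℕ} (u : GaugeTransf P j (Matrix.specialUnitaryGroup n ℂ))
    (U₀ W : GaugeField P j (Matrix.specialUnitaryGroup n ℂ)) (b : PBond P j) :
    1 + pertVar U₀ (GaugeField.gaugeAct u U₀) b
      = ((u b.src : Matrix.specialUnitaryGroup n ℂ) : Matrix n n ℂ) * star (1 + pertVar U₀ W b) * star ((u b.src : Matrix.specialUnitaryGroup n ℂ) : Matrix n n ℂ)
          * (1 + pertVar U₀ (GaugeField.gaugeAct u W) b) := by
  have hcoe : ∀ Z : GaugeField P j (Matrix.specialUnitaryGroup n ℂ), ((GaugeField.gaugeAct u Z b : Matrix.specialUnitaryGroup n ℂ) : Matrix n n ℂ)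
      = ((u b.src : Matrix.specialUnitaryGroup n ℂ) : Matrix n n ℂ) * ((Z b : Matrix.specialUnitaryGroup n ℂ) : Matrix n n ℂ) * star ((u b.tgt : Matrix.specialUnitaryGroup n ℂ) : Matrix n n ℂ) := by
    intro Z
    show (((u b.src * Z b * (u b.tgt)⁻¹ : Matrix.specialUnitaryGroup n ℂ)) : Matrix n n ℂ) = _
    rw [Submonoid.coe_mul, Submonoid.coe_mul]
    rfl
  have hgg' : ∀ X : Matrix n n ℂ, star ((u b.src : Matrix.specialUnitaryGroup n ℂ) : Matrix n n ℂ) * (((u b.src : Matrix.specialUnitaryGroup n ℂ) : Matrix n n ℂ) * X) = X :=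
    fun X => by rw [← mul_assoc, Unitary.star_mul_self_of_mem (u b.src).2.1, one_mul]
  have hww' : ∀ X : Matrix n n ℂ, star ((W b : Matrix.specialUnitaryGroup n ℂ) : Matrix n n ℂ) * (((W b : Matrix.specialUnitaryGroup n ℂ) : Matrix n n ℂ) * X) = X :=
    fun X => by rw [← mul_assoc, Unitary.star_mul_self_of_mem (W b).2.1, one_mul]
  rw [pertVar_eq, pertVar_eq, pertVar_eq, hcoe, hcoe, add_sub_cancel, add_sub_cancel, add_sub_cancel]
  simp only [star_mul, star_star, mul_assoc, hgg', hww']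


/-- ★ **THE DRIFT IN TERMS OF THE TWO RATIOS**: `D_b = gY_b^*g^* + Y′_b + (gY_b^*g^*)·Y′_b`, `g = u(b₋)`. [cite: Balaban1985Variational, (15) p.280] -/
theorem pertVar_gaugeAct_background_eq {j : ℕ} (u : GaugeTransf P j (Matrix.specialUnitaryGroup n ℂ))
    (U₀ W : GaugeField P j (Matrix.specialUnitaryGroup n ℂ)) (b : PBond P j) :
    pertVar U₀ (GaugeField.gaugeAct u U₀) b
      = ((u b.src : Matrix.specialUnitaryGroup n ℂ) : Matrix n n ℂ) * star (pertVar U₀ W b) * star ((u b.src : Matrix.specialUnitaryGroup n ℂ) : Matrix n n ℂ)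
        + pertVar U₀ (GaugeField.gaugeAct u W) b
        + ((u b.src : Matrix.specialUnitaryGroup n ℂ) : Matrix n n ℂ) * star (pertVar U₀ W b) * star ((u b.src : Matrix.specialUnitaryGroup n ℂ) : Matrix n n ℂ)
          * pertVar U₀ (GaugeField.gaugeAct u W) b := by
  have h := one_add_pertVar_gaugeAct_background_eq u U₀ W b
  have hgg : ((u b.src : Matrix.specialUnitaryGroup n ℂ) : Matrix n n ℂ) * star ((u b.src : Matrix.specialUnitaryGroup n ℂ) : Matrix n n ℂ) = 1 :=
    Unitary.mul_star_self_of_mem (u b.src).2.1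
  have e : pertVar U₀ (GaugeField.gaugeAct u U₀) b = (1 + pertVar U₀ (GaugeField.gaugeAct u U₀) b) - 1 := by abel
  rw [e, h, star_add, star_one]
  simp only [mul_add, add_mul, mul_one, one_mul, mul_assoc, hgg]
  abel

/-- ★ **THE SUP LETTER OF THE DRIFT**: `‖(U₀^u)_bU₀(b)^* − 1‖ ≤ ‖Y_b‖ + ‖Y′_b‖ + ‖Y_b‖·‖Y′_b‖` — no division, no smallness: the background moves (in sup) by at most the two
sups of the competitor before and after the move. [cite: Balaban1985Variational, (15)-(16) p.280] -/
theorem norm_pertVar_gaugeAct_background_le {j : ℕ} (u : GaugeTransf P j (Matrix.specialUnitaryGroup n ℂ))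
    (U₀ W : GaugeField P j (Matrix.specialUnitaryGroup n ℂ)) (b : PBond P j) :
    ‖pertVar U₀ (GaugeField.gaugeAct u U₀) b‖ ≤ ‖pertVar U₀ W b‖ + ‖pertVar U₀ (GaugeField.gaugeAct u W) b‖
      + ‖pertVar U₀ W b‖ * ‖pertVar U₀ (GaugeField.gaugeAct u W) b‖ := by
  have hconj : ‖((u b.src : Matrix.specialUnitaryGroup n ℂ) : Matrix n n ℂ) * star (pertVar U₀ W b) * star ((u b.src : Matrix.specialUnitaryGroup n ℂ) : Matrix n n ℂ)‖
      = ‖pertVar U₀ W b‖ := by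
    rw [CStarRing.norm_mul_mem_unitary _ (Unitary.star_mem (u b.src).2.1), CStarRing.norm_mem_unitary_mul _ (u b.src).2.1, norm_star]
  rw [pertVar_gaugeAct_background_eq u U₀ W b]
  refine (norm_add_le _ _).trans ?_
  refine (add_le_add (norm_add_le _ _) (norm_mul_le _ _)).trans ?_
  rw [hconj]

/-! ## §3 `SU(n)`, the `(0.4)`-averages: the drift's per-bond sup on the fibre from the plaquette bound and the two sups -/

/-- ★★ **THE OFF-FIBRE CONSTRAINT VALUE OF A GAUGE-MOVED COMPETITOR IS SMALL PER COARSE BOND**: `k < m + K`; `U₀` with `dist1(U₀(∂p)) ≤ δ` for every finest plaquette; `W` on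
`U₀`'s `(0.4)`-fibre (`avg^k W = avg^k U₀`, averages `blockAvg ℰp = expMeanLogSU`) with `‖W_bU₀(b)^* − 1‖ ≤ s`; `u` ANY finest gauge transformation with `‖(W^u)_bU₀(b)^* − 1‖ ≤ s′`;
the four smallness rows of ✓ `Prop7FibreLevelSup` at level `k` with `(ρ, η) := (s + s′ + ss′, (d−1)·2L^k·δ)`.  THEN the true constraint value of the moved competitor satisfies
`‖pertVar (avg^k U₀) (avg^k (W^u)) c‖ ≤ 2·((d+1)L^k·(s + s′ + ss′))` for every `k`-bond `c` (§1 + §2 + ✓ `Prop7FibreLevelSupLocalGauge.norm_pertVar_iter_le_of_plaqBound` at the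
pure-gauge pair `(U₀^u, U₀)`). [cite: Balaban1985Averaging, Prop. 4 (134)-(135) p.38; Balaban1987RG1, (0.4) p.253, (1.11)-(1.12) p.262] -/
theorem norm_fibreDrift_le_of_plaqBound {k : ℕ} (hk : k < P.m + P.K) (u : GaugeTransf P 0 (Matrix.specialUnitaryGroup n ℂ))
    (U₀ W : GaugeField P 0 (Matrix.specialUnitaryGroup n ℂ))
    (hfib : Averaging.iter (fun i => blockAvg (P := P) (j := i) (expMeanLogSU (n := n))) k W = Averaging.iter (fun i => blockAvg (P := P) (j := i) (expMeanLogSU (n := n))) k U₀)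
    {δ s s' : ℝ} (hδ0 : 0 ≤ δ) (hs0 : 0 ≤ s) (hs'0 : 0 ≤ s')
    (hU : ∀ p : Plaq P 0, dist1 (GaugeField.plaqHol U₀ p) ≤ δ)
    (hs : ∀ b : PBond P 0, ‖pertVar U₀ W b‖ ≤ s) (hs' : ∀ b : PBond P 0, ‖pertVar U₀ (GaugeField.gaugeAct u W) b‖ ≤ s')
    (hmδ : (((P.d : ℝ) + 1) * ((18 : ℝ) ^ P.d * (2 + ((P.d : ℝ) + 1) * (18 : ℝ) ^ P.d)) * (324 * (((P.d + 2) * P.L : ℕ) : ℝ) ^ 2) /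
        ((P.L : ℝ) * ((P.L : ℝ) - 1))) * (((P.d : ℝ) + 1) * (P.L : ℝ) ^ k * (((P.d - 1 : ℕ) : ℝ) * (2 * (P.L : ℝ) ^ k) * δ)) ≤ 1)
    (h200 : 200 * (((P.d + 2) * P.L : ℕ) : ℝ) * ((((P.d : ℝ) + 1) * (P.L : ℝ) ^ k * (s + s' + s * s')) + (((P.d : ℝ) + 1) * (P.L : ℝ) ^ k * (((P.d - 1 : ℕ) : ℝ) * (2 * (P.L : ℝ) ^ k) * δ))) ≤ 1)
    (hm : (((P.d : ℝ) + 1) * ((18 : ℝ) ^ P.d * (2 + ((P.d : ℝ) + 1) * (18 : ℝ) ^ P.d)) * (5200 * (((P.d + 2) * P.L : ℕ) : ℝ) ^ 2) /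
        ((P.L : ℝ) * ((P.L : ℝ) - 1))) * ((((P.d : ℝ) + 1) * (P.L : ℝ) ^ k * (s + s' + s * s')) + (((P.d : ℝ) + 1) * (P.L : ℝ) ^ k * (((P.d - 1 : ℕ) : ℝ) * (2 * (P.L : ℝ) ^ k) * δ))) ≤ 1)
    (hNδ : 4 * (((P.d + 2) * P.L : ℕ) : ℝ) * ((((P.d : ℝ) + 1) * (P.L : ℝ) ^ k * (s + s' + s * s')) + (((P.d : ℝ) + 1) * (P.L : ℝ) ^ k * (((P.d - 1 : ℕ) : ℝ) * (2 * (P.L : ℝ) ^ k) * δ))) < deltaSU n)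
    (c : PBond P k) :
    ‖pertVar (Averaging.iter (fun i => blockAvg (P := P) (j := i) (expMeanLogSU (n := n))) k U₀)
        (Averaging.iter (fun i => blockAvg (P := P) (j := i) (expMeanLogSU (n := n))) k (GaugeField.gaugeAct u W)) c‖
      ≤ 2 * (((P.d : ℝ) + 1) * (P.L : ℝ) ^ k * (s + s' + s * s')) := by
  rw [pertVar_iter_gaugeAct_of_fibre _ hk.le u U₀ W hfib c]
  -- the sup of the pure-gauge pair `(U₀^u, U₀)`
  have hρ : ∀ e : PBond P 0, ‖((GaugeField.gaugeAct u U₀ e : Matrix.specialUnitaryGroup n ℂ) : Matrix n n ℂ) - ((U₀ e : Matrix.specialUnitaryGroup n ℂ) : Matrix n n ℂ)‖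
      ≤ s + s' + s * s' := by
    intro e
    have hn : ‖((GaugeField.gaugeAct u U₀ e : Matrix.specialUnitaryGroup n ℂ) : Matrix n n ℂ) - ((U₀ e : Matrix.specialUnitaryGroup n ℂ) : Matrix n n ℂ)‖
        = ‖pertVar U₀ (GaugeField.gaugeAct u U₀) e‖ := by
      rw [pertVar_eq]
      have e1 : ((GaugeField.gaugeAct u U₀ e : Matrix.specialUnitaryGroup n ℂ) : Matrix n n ℂ) * star ((U₀ e : Matrix.specialUnitaryGroup n ℂ) : Matrix n n ℂ) - 1
          = (((GaugeField.gaugeAct u U₀ e : Matrix.specialUnitaryGroup n ℂ) : Matrix n n ℂ) - ((U₀ e : Matrix.specialUnitaryGroup n ℂ) : Matrix n n ℂ))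
              * star ((U₀ e : Matrix.specialUnitaryGroup n ℂ) : Matrix n n ℂ) := by
        rw [sub_mul, Unitary.mul_star_self_of_mem (U₀ e).2.1]
      rw [e1, CStarRing.norm_mul_mem_unitary _ (Unitary.star_mem (U₀ e).2.1)]
    rw [hn]
    refine (norm_pertVar_gaugeAct_background_le u U₀ W e).trans ?_
    have h1 := hs e; have h2 := hs' e
    have h3 : ‖pertVar U₀ W e‖ * ‖pertVar U₀ (GaugeField.gaugeAct u W) e‖ ≤ s * s' := mul_le_mul h1 h2 (norm_nonneg _) hs0
    linarith
  exact norm_pertVar_iter_le_of_plaqBound hk c (GaugeField.gaugeAct u U₀) U₀ (by positivity) hδ0 hU hρ hmδ h200 hm hNδ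

end Summit.QuantumFields.YangMills.Theorems.Prop7FibreDriftLetter

end
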